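import Summits.HubbardSuperconductivity.HubbardSuperconductivity.Theorems.SoloBlindPenaltyTransfer
import Summits.HubbardSuperconductivity.HubbardSuperconductivity.Theorems.SoloBlindCertificateForm
import HarnessLib

/-!
# Solo-blind obstruction analysis, Theorem 19(f),(g): a primal witness IS a dual certificate,
# and an `L`-independent tolerance IS the robust window target

[this work] The finite-volume content of `HubbardSuperconductivity` has been put in two
equivalent shapes: the DUAL certificate of Theorem 3 (`SoloBlindCertificateForm`,
`hubbardSuperconductivity_iff_certificate`: a multiplier `κ_L ≥ 0` with
`c L⁴ ≤ re ⟨ψ, O_L ψ⟩ + κ_L (re ⟨ψ, H_L ψ⟩ − E₀)` for EVERY unit `ψ` of the sector,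
`O_L = (√2Δ_d)†(√2Δ_d)`), and the PRIMAL witness of Theorem 19
(`SoloBlindPenaltyEnergyPrice`, `hubbardSuperconductivity_iff_approx_penalised_state`: ONE unit
`χ` of the sector with `re ⟨χ, O_L χ⟩ ≥ c L⁴` whose PENALISED energy
`re ⟨χ, (H_L + s O_L) χ⟩` is within `s c L⁴/2` of `minEnergyOn (H_L + s O_L)` on the sector).
Theorem 17 (`penalised_minimiser_re_rayleigh_ge_of_certificate`) turns a certificate with
multiplier `κ` into a witness at penalty `s ≍ c/κ`. This file records the converse and its
consequence for the ROBUST target of Theorem 8 (`SoloBlindSpectralWindow`), all by the same three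
inequalities as Theorem 19(a), read for an arbitrary unit vector instead of a ground state:

* `certificate_of_approx_penalised` (abstract; `A`, `O` Hermitian, `K` a subspace, `s > 0`):
  a witness `χ ∈ K`, `‖χ‖ = 1`, `re ⟨χ,(A+sO)χ⟩ ≤ minEnergyOn (A+sO) K + ε`, `re ⟨χ,Oχ⟩ ≥ a`
  gives, for EVERY unit `ψ ∈ K`,
  `a − ε/s ≤ re ⟨ψ,Oψ⟩ + s⁻¹ (re ⟨ψ,Aψ⟩ − minEnergyOn A K)` — the certificate with `κ = 1/s`.
* `lowEnergy_re_rayleigh_ge_of_approx_penalised`: hence every unit `ψ ∈ K` with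
  `re ⟨ψ,Aψ⟩ ≤ minEnergyOn A K + η` has `re ⟨ψ,Oψ⟩ ≥ a − (ε + η)/s`: the witness controls not only
  the ground states of `A` (Theorem 19(a), `η = 0`) but its whole low-energy window, of width
  proportional to `s`.
* `certificate_of_lowEnergy_bound`, `penalised_minimiser_re_rayleigh_ge_of_lowEnergy_bound`
  (abstract, `O ≥ 0`, `re ⟨φ,Oφ⟩ ≤ B` on unit vectors of `K`): conversely, order `≥ a` on the
  pointwise window `{ψ : re ⟨ψ,Aψ⟩ ≤ E₀ + η}` is the certificate with `κ = a/η`, and then every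
  penalised minimiser at any penalty `0 < s ≤ η/(2B)` has order `≥ a/2`.
* Hubbard torus (`hubbardTorus 2 L t U`, any `t, U`, any joint sector, `O = (√2Δ_d)†(√2Δ_d)`,
  `re ⟨ψ,Oψ⟩ ≤ 400 L⁴`): `dWave_certificate_of_witness` (witness at penalty `s`, tolerance
  `s a/2` ⇒ certificate with `κ = 1/s`, constant `a/2`), `dWave_lowEnergy_order_of_witness`
  (⇒ order `≥ a/4` on every unit vector of the sector with energy `≤ E₀ + s a/4`), and
  `dWave_penalised_minimiser_order_of_lowEnergy_order` (order `≥ a` on the window of width `η`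
  ⇒ every penalised sector minimiser at `0 < s ≤ η/(800 L⁴)` has order `≥ a/2`, a witness of
  Theorem 19(c) with tolerance `0`).

So, with `a = c L⁴`: the penalty scale `s_L` of the primal form, the inverse multiplier `1/κ_L`
of the dual form and the window width `η_L / (c L⁴)` of the robust form are ONE quantity up to
constants; "an `L`-independent energy tolerance `s_L c L⁴/2`" (bounded above by
`96π²⌈2400/c⌉²|t|`, Theorem 19(e)) is the same statement as "d-wave order on an `L`-independent
energy window above the sector ground energy" (Theorem 8's R1⁺, `κ_L = Θ(L⁴)`), and under the bare
summit only `s_L c L⁴ = Ω(c² γ_L)` (sector gap) is guaranteed (Theorem 3).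

[idea] Primal ⟺ dual ⟺ robust by three variational inequalities each; elementary. [this work]
-/

noncomputable section

namespace Summit.HubbardSuperconductivity.HubbardSuperconductivity.Theorems

open Matrix Literature.Probability.LatticeModels Literature.MathematicalPhysics.QuantumLattice
  Literature.MathematicalPhysics.QuantumLattice.EigenvalueContinuation
open scoped ComplexOrder

/-! ### Abstract: witnesses, certificates and low-energy windows -/

section Abstract

variable {n : Type*} [Fintype n] [DecidableEq n]

omit [DecidableEq n] in
/-- Splitting of the penalised Rayleigh quotient. [folklore] -/
private theorem re_rayleigh_add_smul (A O : Matrix n n ℂ) (s : ℝ) (v : n → ℂ) :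
    (star v ⬝ᵥ (A + (s : ℂ) • O) *ᵥ v).re =
      (star v ⬝ᵥ A *ᵥ v).re + s * (star v ⬝ᵥ O *ᵥ v).re := by
  rw [add_mulVec, smul_mulVec, dotProduct_add, dotProduct_smul, Complex.add_re, smul_eq_mul,
    Complex.re_ofReal_mul]

/-- **Theorem 19(f): a witness is a certificate.** `A`, `O` Hermitian, `K` a subspace, `s > 0`.
A unit vector `χ ∈ K` with `re ⟨χ, (A + sO) χ⟩ ≤ minEnergyOn (A + sO) K + ε` and
`a ≤ re ⟨χ, O χ⟩` yields, for EVERY unit `ψ ∈ K`, the certificate inequality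
`a - ε/s ≤ re ⟨ψ, O ψ⟩ + s⁻¹ (re ⟨ψ, A ψ⟩ - minEnergyOn A K)` (multiplier `κ = 1/s`).
Proof: `E₀(A) + s a ≤ ⟨χ,Aχ⟩ + s⟨χ,Oχ⟩ ≤ E₀(A+sO) + ε ≤ ⟨ψ,Aψ⟩ + s⟨ψ,Oψ⟩ + ε`. [this work] -/
theorem certificate_of_approx_penalised {A O : Matrix n n ℂ} (hA : A.IsHermitian)
    (hO : O.IsHermitian) (K : Submodule ℂ (n → ℂ)) {s : ℝ} (hs : 0 < s) {ε a : ℝ}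
    {χ : n → ℂ} (hχK : χ ∈ K) (hχ1 : star χ ⬝ᵥ χ = 1)
    (hχE : (star χ ⬝ᵥ (A + (s : ℂ) • O) *ᵥ χ).re ≤ (A + (s : ℂ) • O).minEnergyOn K + ε)
    (ha : a ≤ (star χ ⬝ᵥ O *ᵥ χ).re)
    {ψ : n → ℂ} (hψK : ψ ∈ K) (hψ1 : star ψ ⬝ᵥ ψ = 1) :
    a - ε / s ≤ (star ψ ⬝ᵥ O *ᵥ ψ).re + s⁻¹ * ((star ψ ⬝ᵥ A *ᵥ ψ).re - A.minEnergyOn K) := by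
  have hB : (A + (s : ℂ) • O).IsHermitian := isHermitian_add_ofReal_smul hA hO s
  -- `E₀(A+sO) ≤ ⟨ψ,Aψ⟩ + s⟨ψ,Oψ⟩`
  have h1 : (A + (s : ℂ) • O).minEnergyOn K ≤
      (star ψ ⬝ᵥ A *ᵥ ψ).re + s * (star ψ ⬝ᵥ O *ᵥ ψ).re := by
    have h := minEnergyOn_le_rayleigh_of_mem hB K hψK hψ1
    rwa [re_rayleigh_add_smul] at h
  -- `E₀(A) ≤ ⟨χ, A χ⟩`
  have h2 : A.minEnergyOn K ≤ (star χ ⬝ᵥ A *ᵥ χ).re := by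
    have h := minEnergyOn_mul_le_re_rayleigh hA K hχK
    rwa [hχ1, Complex.one_re, mul_one] at h
  rw [re_rayleigh_add_smul] at hχE
  have h3 : s * a ≤ s * (star χ ⬝ᵥ O *ᵥ χ).re := mul_le_mul_of_nonneg_left ha hs.le
  have h4 : s * a ≤ ((star ψ ⬝ᵥ A *ᵥ ψ).re - A.minEnergyOn K) +
      s * (star ψ ⬝ᵥ O *ᵥ ψ).re + ε := by linarith
  have h5 : s * (a - ε / s) ≤
      s * ((star ψ ⬝ᵥ O *ᵥ ψ).re + s⁻¹ * ((star ψ ⬝ᵥ A *ᵥ ψ).re - A.minEnergyOn K)) := by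
    have e1 : s * (a - ε / s) = s * a - ε := by field_simp
    have e2 : s * ((star ψ ⬝ᵥ O *ᵥ ψ).re + s⁻¹ * ((star ψ ⬝ᵥ A *ᵥ ψ).re - A.minEnergyOn K)) =
        s * (star ψ ⬝ᵥ O *ᵥ ψ).re + ((star ψ ⬝ᵥ A *ᵥ ψ).re - A.minEnergyOn K) := by
      rw [mul_add, ← mul_assoc, mul_inv_cancel₀ hs.ne', one_mul]
    rw [e1, e2]
    linarith
  exact le_of_mul_le_mul_left h5 hs

/-- **Theorem 19(f): the witness controls the whole low-energy window.** Same witness `χ`; then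
every unit `ψ ∈ K` with `re ⟨ψ, A ψ⟩ ≤ minEnergyOn A K + η` has `a - (ε + η)/s ≤ re ⟨ψ, O ψ⟩`.
Theorem 19(a) is `η = 0`. [this work] -/
theorem lowEnergy_re_rayleigh_ge_of_approx_penalised {A O : Matrix n n ℂ} (hA : A.IsHermitian)
    (hO : O.IsHermitian) (K : Submodule ℂ (n → ℂ)) {s : ℝ} (hs : 0 < s) {ε a : ℝ}
    {χ : n → ℂ} (hχK : χ ∈ K) (hχ1 : star χ ⬝ᵥ χ = 1)
    (hχE : (star χ ⬝ᵥ (A + (s : ℂ) • O) *ᵥ χ).re ≤ (A + (s : ℂ) • O).minEnergyOn K + ε)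
    (ha : a ≤ (star χ ⬝ᵥ O *ᵥ χ).re)
    {η : ℝ} {ψ : n → ℂ} (hψK : ψ ∈ K) (hψ1 : star ψ ⬝ᵥ ψ = 1)
    (hψE : (star ψ ⬝ᵥ A *ᵥ ψ).re ≤ A.minEnergyOn K + η) :
    a - (ε + η) / s ≤ (star ψ ⬝ᵥ O *ᵥ ψ).re := by
  have hB : (A + (s : ℂ) • O).IsHermitian := isHermitian_add_ofReal_smul hA hO s
  have h1 : (A + (s : ℂ) • O).minEnergyOn K ≤
      (star ψ ⬝ᵥ A *ᵥ ψ).re + s * (star ψ ⬝ᵥ O *ᵥ ψ).re := by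
    have h := minEnergyOn_le_rayleigh_of_mem hB K hψK hψ1
    rwa [re_rayleigh_add_smul] at h
  have h2 : A.minEnergyOn K ≤ (star χ ⬝ᵥ A *ᵥ χ).re := by
    have h := minEnergyOn_mul_le_re_rayleigh hA K hχK
    rwa [hχ1, Complex.one_re, mul_one] at h
  rw [re_rayleigh_add_smul] at hχE
  have h3 : s * a ≤ s * (star χ ⬝ᵥ O *ᵥ χ).re := mul_le_mul_of_nonneg_left ha hs.le
  have h4 : s * a ≤ η + s * (star ψ ⬝ᵥ O *ᵥ ψ).re + ε := by linarith
  have h5 : s * (a - (ε + η) / s) ≤ s * (star ψ ⬝ᵥ O *ᵥ ψ).re := by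
    have e1 : s * (a - (ε + η) / s) = s * a - (ε + η) := by field_simp
    rw [e1]
    linarith
  exact le_of_mul_le_mul_left h5 hs

omit [DecidableEq n] in
/-- **Theorem 19(g): order on a pointwise energy window is a certificate.** `A` Hermitian, `O`
with `re ⟨v, O v⟩ ≥ 0`, `η > 0`, `a ≥ 0`: if every unit `ψ ∈ K` with
`re ⟨ψ, A ψ⟩ ≤ minEnergyOn A K + η` has `a ≤ re ⟨ψ, O ψ⟩`, then every unit `ψ ∈ K` satisfies
`a ≤ re ⟨ψ, O ψ⟩ + (a/η) (re ⟨ψ, A ψ⟩ - minEnergyOn A K)`. [folklore] -/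
theorem certificate_of_lowEnergy_bound {A O : Matrix n n ℂ} (hA : A.IsHermitian)
    (K : Submodule ℂ (n → ℂ)) (hO0 : ∀ v : n → ℂ, 0 ≤ (star v ⬝ᵥ O *ᵥ v).re)
    {η a : ℝ} (hη : 0 < η) (ha : 0 ≤ a)
    (hwin : ∀ ψ ∈ K, star ψ ⬝ᵥ ψ = 1 → (star ψ ⬝ᵥ A *ᵥ ψ).re ≤ A.minEnergyOn K + η →
      a ≤ (star ψ ⬝ᵥ O *ᵥ ψ).re) :
    ∀ ψ ∈ K, star ψ ⬝ᵥ ψ = 1 →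
      a ≤ (star ψ ⬝ᵥ O *ᵥ ψ).re + a / η * ((star ψ ⬝ᵥ A *ᵥ ψ).re - A.minEnergyOn K) := by
  intro ψ hψK hψ1
  have hE : A.minEnergyOn K ≤ (star ψ ⬝ᵥ A *ᵥ ψ).re := by
    have h := minEnergyOn_mul_le_re_rayleigh hA K hψK
    rwa [hψ1, Complex.one_re, mul_one] at h
  have hκ : 0 ≤ a / η := div_nonneg ha hη.le
  have hη0 : η ≠ 0 := hη.ne'
  by_cases hlow : (star ψ ⬝ᵥ A *ᵥ ψ).re ≤ A.minEnergyOn K + η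
  · have h1 := hwin ψ hψK hψ1 hlow
    have h2 : 0 ≤ a / η * ((star ψ ⬝ᵥ A *ᵥ ψ).re - A.minEnergyOn K) :=
      mul_nonneg hκ (by linarith)
    linarith
  · have hlow' : A.minEnergyOn K + η < (star ψ ⬝ᵥ A *ᵥ ψ).re := lt_of_not_ge hlow
    have h3 : a / η * η = a := by field_simp
    have h4 : a / η * η ≤ a / η * ((star ψ ⬝ᵥ A *ᵥ ψ).re - A.minEnergyOn K) :=
      mul_le_mul_of_nonneg_left (by linarith) hκ
    have h0 := hO0 ψ
    linarith

omit [DecidableEq n] in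
/-- **Theorem 19(g): order on an energy window survives a proportional penalty.** `A`, `O`
Hermitian, `K ≠ ⊥` invariant under `A`, `0 ≤ re ⟨v, O v⟩`, `re ⟨φ, O φ⟩ ≤ B` on unit vectors of
`K` (`B > 0`). If every unit `ψ ∈ K` with `re ⟨ψ, A ψ⟩ ≤ minEnergyOn A K + η` has
`a ≤ re ⟨ψ, O ψ⟩` (`η > 0`, `a ≥ 0`), then for every `0 < s ≤ η/(2B)` every unit minimiser `φ_s` of
`A + sO` on `K` has `a/2 ≤ re ⟨φ_s, O φ_s⟩`. (The certificate `κ = a/η` of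
`certificate_of_lowEnergy_bound` fed into `penalised_minimiser_re_rayleigh_ge_of_certificate`.)
[this work] -/
theorem penalised_minimiser_re_rayleigh_ge_of_lowEnergy_bound {A O : Matrix n n ℂ}
    (hA : A.IsHermitian) (hO : O.IsHermitian) (K : Submodule ℂ (n → ℂ))
    (hKA : ∀ v ∈ K, A *ᵥ v ∈ K) (hK : K ≠ ⊥)
    (hO0 : ∀ v : n → ℂ, 0 ≤ (star v ⬝ᵥ O *ᵥ v).re) {B : ℝ} (hB : 0 < B)
    (hOB : ∀ φ ∈ K, star φ ⬝ᵥ φ = 1 → (star φ ⬝ᵥ O *ᵥ φ).re ≤ B)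
    {η a : ℝ} (hη : 0 < η) (ha : 0 ≤ a)
    (hwin : ∀ ψ ∈ K, star ψ ⬝ᵥ ψ = 1 → (star ψ ⬝ᵥ A *ᵥ ψ).re ≤ A.minEnergyOn K + η →
      a ≤ (star ψ ⬝ᵥ O *ᵥ ψ).re)
    {s : ℝ} (hs : 0 < s) (hsη : s ≤ η / (2 * B))
    {φs : n → ℂ} (hφsK : φs ∈ K) (hφs1 : star φs ⬝ᵥ φs = 1)
    (hφsE : (star φs ⬝ᵥ (A + (s : ℂ) • O) *ᵥ φs).re ≤ (A + (s : ℂ) • O).minEnergyOn K) :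
    a / 2 ≤ (star φs ⬝ᵥ O *ᵥ φs).re := by
  have hcert := certificate_of_lowEnergy_bound hA K hO0 hη ha hwin
  have hκ : 0 ≤ a / η := div_nonneg ha hη.le
  have hsB : a / η * s * B ≤ a / 2 := by
    have h1 : s * (2 * B) ≤ η := (le_div_iff₀ (by positivity)).mp hsη
    have h2 : a / η * s * B = a / η * (s * B) := by ring
    have h3 : a / η * (s * B) ≤ a / η * (η / 2) :=
      mul_le_mul_of_nonneg_left (by linarith) hκ
    have h4 : a / η * (η / 2) = a / 2 := by
      rw [div_mul_div_comm, mul_comm a η, mul_div_mul_left _ _ hη.ne']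
    linarith
  exact penalised_minimiser_re_rayleigh_ge_of_certificate hA hO K hKA hK hO0 hOB hκ hcert hs hsB
    hφsK hφs1 hφsE

end Abstract

/-! ### The Hubbard torus -/

section Hubbard

/-- **Theorem 19(f), Hubbard: a d-wave witness is a d-wave certificate.** For
`H = hubbardTorus 2 L t U` (`L = n+1`, any `t, U`), any joint sector `K = (N, S^z = M_z)`,
`O = (√2Δ_d)†(√2Δ_d)`, `s > 0`: one unit `χ ∈ K` with `re ⟨χ, (H + sO) χ⟩ ≤ minEnergyOn (H + sO) K
+ s a / 2` and `a ≤ re ⟨χ, O χ⟩` gives the certificate of `hubbardSuperconductivity_iff_certificate`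
on `K` with constant `a/2` and multiplier `κ = s⁻¹`. [this work] -/
theorem dWave_certificate_of_witness (t U : ℝ) {n N : ℕ} {Mz s a : ℝ} (hs : 0 < s)
    {χ : Fock (Orb (FermionTorus 2 (n + 1)))} (hχ1 : star χ ⬝ᵥ χ = 1)
    (hχK : χ ∈ szSector (Λ := FermionTorus 2 (n + 1)) N Mz)
    (hχE : (star χ ⬝ᵥ (hubbardTorus 2 (n + 1) t U + (s : ℂ) •
        ((pairField dWaveFormFactor (n + 1))ᴴ * pairField dWaveFormFactor (n + 1))) *ᵥ χ).re ≤
      (hubbardTorus 2 (n + 1) t U + (s : ℂ) •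
          ((pairField dWaveFormFactor (n + 1))ᴴ * pairField dWaveFormFactor (n + 1))).minEnergyOn
        (szSector (Λ := FermionTorus 2 (n + 1)) N Mz) + s * a / 2)
    (ha : a ≤ (expect ((pairField dWaveFormFactor (n + 1))ᴴ * pairField dWaveFormFactor (n + 1))
      χ).re) :
    ∀ ψ ∈ szSector (Λ := FermionTorus 2 (n + 1)) N Mz, star ψ ⬝ᵥ ψ = 1 →
      a / 2 ≤
        (expect ((pairField dWaveFormFactor (n + 1))ᴴ * pairField dWaveFormFactor (n + 1)) ψ).re +
          s⁻¹ * ((star ψ ⬝ᵥ hubbardTorus 2 (n + 1) t U *ᵥ ψ).re -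
            (hubbardTorus 2 (n + 1) t U).minEnergyOn
              (szSector (Λ := FermionTorus 2 (n + 1)) N Mz)) := by
  intro ψ hψK hψ1
  have h := certificate_of_approx_penalised (isHermitian_hubbardTorus (n + 1) t U)
    (isHermitian_conjTranspose_mul_self _) _ hs hχK hχ1 hχE ha hψK hψ1
  have hε : s * a / 2 / s = a / 2 := by field_simp
  rw [hε] at h
  change a / 2 ≤ (star ψ ⬝ᵥ (((pairField dWaveFormFactor (n + 1))ᴴ *
    pairField dWaveFormFactor (n + 1)) *ᵥ ψ)).re + _
  linarith

/-- **Theorem 19(f), Hubbard: a d-wave witness gives ROBUST d-wave order.** Same witness; then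
every unit `ψ` of the sector with energy `re ⟨ψ, H ψ⟩ ≤ minEnergyOn H K + s a / 4` has
`a/4 ≤ re ⟨ψ, O ψ⟩` — d-wave order on the whole energy window of width `s a/4` above the sector
ground energy (Theorem 8's robust target, window `L`-independent iff `s a` is). [this work] -/
theorem dWave_lowEnergy_order_of_witness (t U : ℝ) {n N : ℕ} {Mz s a : ℝ} (hs : 0 < s)
    {χ : Fock (Orb (FermionTorus 2 (n + 1)))} (hχ1 : star χ ⬝ᵥ χ = 1)
    (hχK : χ ∈ szSector (Λ := FermionTorus 2 (n + 1)) N Mz)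
    (hχE : (star χ ⬝ᵥ (hubbardTorus 2 (n + 1) t U + (s : ℂ) •
        ((pairField dWaveFormFactor (n + 1))ᴴ * pairField dWaveFormFactor (n + 1))) *ᵥ χ).re ≤
      (hubbardTorus 2 (n + 1) t U + (s : ℂ) •
          ((pairField dWaveFormFactor (n + 1))ᴴ * pairField dWaveFormFactor (n + 1))).minEnergyOn
        (szSector (Λ := FermionTorus 2 (n + 1)) N Mz) + s * a / 2)
    (ha : a ≤ (expect ((pairField dWaveFormFactor (n + 1))ᴴ * pairField dWaveFormFactor (n + 1))
      χ).re)
    {ψ : Fock (Orb (FermionTorus 2 (n + 1)))} (hψ1 : star ψ ⬝ᵥ ψ = 1)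
    (hψK : ψ ∈ szSector (Λ := FermionTorus 2 (n + 1)) N Mz)
    (hψE : (star ψ ⬝ᵥ hubbardTorus 2 (n + 1) t U *ᵥ ψ).re ≤
      (hubbardTorus 2 (n + 1) t U).minEnergyOn (szSector (Λ := FermionTorus 2 (n + 1)) N Mz) +
        s * a / 4) :
    a / 4 ≤
      (expect ((pairField dWaveFormFactor (n + 1))ᴴ * pairField dWaveFormFactor (n + 1)) ψ).re := by
  have h := lowEnergy_re_rayleigh_ge_of_approx_penalised (isHermitian_hubbardTorus (n + 1) t U)
    (isHermitian_conjTranspose_mul_self _) _ hs hχK hχ1 hχE ha hψK hψ1 hψE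
  have h1 : s * a / 2 / s = a / 2 := by field_simp
  have h2 : s * a / 4 / s = a / 4 := by field_simp
  rw [add_div, h1, h2] at h
  change a / 4 ≤ (star ψ ⬝ᵥ (((pairField dWaveFormFactor (n + 1))ᴴ *
    pairField dWaveFormFactor (n + 1)) *ᵥ ψ)).re
  linarith

/-- **Theorem 19(g), Hubbard: robust d-wave order gives an exact penalised witness at a
proportional penalty.** For `H = hubbardTorus 2 L t U` (`L = n+1`), a non-trivial joint sector
`K`, `O = (√2Δ_d)†(√2Δ_d)` (`re ⟨ψ,Oψ⟩ ≤ 400 L⁴‖ψ‖²`), `η > 0`, `a ≥ 0`: if every unit `ψ ∈ K` with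
`re ⟨ψ, H ψ⟩ ≤ minEnergyOn H K + η` has `a ≤ re ⟨ψ, O ψ⟩`, then for every `0 < s ≤ η/(800 L⁴)`
every unit minimiser `φ_s ∈ K` of `H + sO` on `K` — in particular every sector ground state of the
penalised Hamiltonian — has `a/2 ≤ re ⟨φ_s, O φ_s⟩`: a witness of Theorem 19(c) with tolerance `0`
at a penalty with `s a ≍ η a/L⁴`, i.e. `s c L⁴ ≍ c η` for `a = c L⁴`. [this work] -/
theorem dWave_penalised_minimiser_order_of_lowEnergy_order (t U : ℝ) {n N : ℕ} {Mz : ℝ}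
    (hK : szSector (Λ := FermionTorus 2 (n + 1)) N Mz ≠ ⊥) {η a : ℝ} (hη : 0 < η) (ha : 0 ≤ a)
    (hwin : ∀ ψ ∈ szSector (Λ := FermionTorus 2 (n + 1)) N Mz, star ψ ⬝ᵥ ψ = 1 →
      (star ψ ⬝ᵥ hubbardTorus 2 (n + 1) t U *ᵥ ψ).re ≤
          (hubbardTorus 2 (n + 1) t U).minEnergyOn (szSector (Λ := FermionTorus 2 (n + 1)) N Mz)
            + η →
        a ≤ (expect ((pairField dWaveFormFactor (n + 1))ᴴ * pairField dWaveFormFactor (n + 1))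
          ψ).re)
    {s : ℝ} (hs : 0 < s) (hsη : s ≤ η / (800 * ((n + 1 : ℕ) : ℝ) ^ 4))
    {φ : Fock (Orb (FermionTorus 2 (n + 1)))} (hφ1 : star φ ⬝ᵥ φ = 1)
    (hφK : φ ∈ szSector (Λ := FermionTorus 2 (n + 1)) N Mz)
    (hφE : (star φ ⬝ᵥ (hubbardTorus 2 (n + 1) t U + (s : ℂ) •
        ((pairField dWaveFormFactor (n + 1))ᴴ * pairField dWaveFormFactor (n + 1))) *ᵥ φ).re ≤
      (hubbardTorus 2 (n + 1) t U + (s : ℂ) •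
          ((pairField dWaveFormFactor (n + 1))ᴴ * pairField dWaveFormFactor (n + 1))).minEnergyOn
        (szSector (Λ := FermionTorus 2 (n + 1)) N Mz)) :
    a / 2 ≤
      (expect ((pairField dWaveFormFactor (n + 1))ᴴ * pairField dWaveFormFactor (n + 1)) φ).re := by
  set O := (pairField dWaveFormFactor (n + 1))ᴴ * pairField dWaveFormFactor (n + 1) with hO
  have hB : ∀ ψ ∈ szSector (Λ := FermionTorus 2 (n + 1)) N Mz, star ψ ⬝ᵥ ψ = 1 →
      (star ψ ⬝ᵥ O *ᵥ ψ).re ≤ 400 * ((n + 1 : ℕ) : ℝ) ^ 4 := by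
    intro ψ _ hψ1
    have h := pairField_order_le dWaveFormFactor GaugeTwist.abs_dWaveFormFactor_le_one ψ
    rw [hψ1, Complex.one_re, mul_one] at h
    rwa [hO, ← mulVec_mulVec, dotProduct_mulVec, ← star_mulVec]
  have hBpos : (0 : ℝ) < 400 * ((n + 1 : ℕ) : ℝ) ^ 4 := by positivity
  have hsη' : s ≤ η / (2 * (400 * ((n + 1 : ℕ) : ℝ) ^ 4)) := by
    have : 2 * (400 * ((n + 1 : ℕ) : ℝ) ^ 4) = 800 * ((n + 1 : ℕ) : ℝ) ^ 4 := by ring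
    rwa [this]
  exact penalised_minimiser_re_rayleigh_ge_of_lowEnergy_bound
    (isHermitian_hubbardTorus (n + 1) t U) (isHermitian_conjTranspose_mul_self _) _
    (fun v hv => hubbardTorus_mulVec_mem_szSector t U hv) hK
    (fun v => re_expect_pairField_nonneg dWaveFormFactor n v) hBpos hB hη ha
    (fun ψ hψK hψ1 hψE => hwin ψ hψK hψ1 hψE) hs hsη' hφK hφ1 hφE

end Hubbard

end Summit.HubbardSuperconductivity.HubbardSuperconductivity.Theorems

end

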